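import Literature.NumberTheory.Automorphic.CDTTheorem722
import Literature.NumberTheory.Automorphic.CDTTheorem712
import Literature.NumberTheory.Automorphic.BCDTModularity
import Literature.NumberTheory.Automorphic.BCDTModularityModPProofs
import Literature.NumberTheory.Automorphic.HeckeAlgebraOfTypeSigma
import Literature.NumberTheory.Automorphic.ChebotarevArtinRepHolds
import Literature.NumberTheory.EllipticCurves.FramedTateGaloisRep
import Literature.NumberTheory.EllipticCurves.FrobeniusTraceBaseChange
import Literature.NumberTheory.EllipticCurves.FrobeniusTateModuleProofs
import Literature.NumberTheory.EllipticCurves.TateModuleFreeProofs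
import Literature.NumberTheory.EllipticCurves.TateModuleFinrankProofs
import Literature.NumberTheory.EllipticCurves.NewformGaloisRepModLOfPadicAlgClProofs
import Literature.NumberTheory.EllipticCurves.ModularityVersionApProofs
import Literature.NumberTheory.GaloisRepresentations.FramedRepBaseChange
import Literature.NumberTheory.GaloisRepresentations.ResidualGaloisRep
import Literature.NumberTheory.GaloisRepresentations.ResidualRepRestrict
import Literature.NumberTheory.GaloisRepresentations.PatchingLemma
import Literature.NumberTheory.GaloisRepresentations.FrobeniusDensity
import Literature.NumberTheory.GaloisRepresentations.IrreducibleOfIrreducibleReduction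
import Literature.NumberTheory.GaloisRepresentations.OrdinaryGaloisRep
import Literature.NumberTheory.GaloisRepresentations.CalegariEvenFontaineMazurTwo
import Literature.NumberTheory.GaloisRepresentations.AbsolutelyIrreducibleReduction
import Literature.NumberTheory.GaloisRepresentations.ResidualRepOfTraceCongruence
import Literature.RepresentationTheory.Semisimple.IrreducibleOfCharpoly
import Literature.NumberTheory.DiophantineGeometry.Conductor
import Literature.FieldTheory.AlgClosed.PadicAlgClEquivComplex
import Literature.RingTheory.CompleteIntersection.CongruenceModule
import Mathlib.RingTheory.Length
import Mathlib.RingTheory.DiscreteValuationRing.Basic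
import HarnessLib

/-!
# Stub-ideation k = 2, GENERATION 12 (home family 2 = RESHAPE) for `stub_liftFive` of crux
# `FreyModularity` (stmt-ABC-11340, route ABC/DefiniteXi, line `Lines/Sketch.lean` sha 21576c53)

Companion of `STUB-IDEAS-stub_liftFive-2.md` (gen 12).  `stub_liftFive` (Diamond 1996 Thm. 5.3 =
`CDT_theorem_7_2_2 ∩ {25 ∤ N}`) is consumed ONCE, in case B of `isModular_freyCurve_of_stubs`, where
the Frey curve is semistable and MULTIPLICATIVE at `5` — which is exactly the regime of
Darmon–Diamond–Taylor §3.3–3.5 with `ℓ = 5` (Thm. 3.42 `φ_Σ : R_Σ ≅ T_Σ`, Cor. 3.46 "`ρ` is modular",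
p. 103: "applying corollary 3.46 with `ℓ = 5` … `ρ_{E,5}` is modular").

Gens 7–11 of this seat rewrote the one opaque debt four times, always in LIFT / TRACE currency
(X′ conjugacy ⟸ X″ traces ⟸ X‴ Frobenius traces ⟸ X⁵ `DiamondCor62FrobTraceFiveOrd`, the W-free
Galois-level form; all adapters PROVED).  Every version is still the OUTPUT SENTENCE of an
`R_Σ = T_Σ` theorem.  **Gen 12 changes currency to LENGTHS** (two techniques deep):

* **T-A (reformulate as a ring statement over a posited interface).**  `RTDatum` = an abstract
  "`R → T` datum of type `S`" (interface: `φ : R →ₐ[O] T`, augmentation `π : T →ₐ[O] O`, Frobenius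
  elements `trR v ↦ trT v`, and the two INTERPRETATION axioms actually consumed downstream —
  `univ`: every type-`S` lift `τ` gives an `O`-compatible point `ψ_τ : R → ℚ̄₅` with `ψ_τ(trR v) =
  tr τ(Frob_v)` (DDT Thm. 2.41), `modular`: every `O`-compatible point `θ : T → ℚ̄₅` is a member of
  Diamond's `Φ_S` (DDT Remark 3.33)); existence is NEVER smuggled in: it is the separate statement
  `RTIsoExists` / `RTNumericalExists`.  PROVED here: **OUT** `x5_of_rtIsoExists`
  (`∃` datum with `φ` bijective ⇒ X⁵, pure algebra: `θ := ψ_τ ∘ φ⁻¹`, = DDT proof of Cor. 3.46).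
* **T-B (strengthen to simplify: the NEW TOOL is the tree's PROVED numerical criterion).**
  `R_S ≅ T_S` is cashed by de Smit–Rubin–Schoof Criterion I, in the tree and sorry-free as
  `Literature.RingTheory.CompleteIntersection.bijective_of_length_cotangentModule_le`
  (= DDT Thm. 3.40 (a) ⇒ (c), iso half; restated VERBATIM as the Prop `CriterionI` because the
  farm snapshot of this check had `CriterionOne` unbuilt): PROVED here **ISO**
  `rtIsoExists_of_numerical` (`CriterionI → RTNumericalExists → RTIsoExists`).  So the debt is now `RTNumericalExists` = SURJ ∧ (η ≠ 0) ∧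
  **INEQ `length_O(℘_S/℘_S²) ≤ length_O(O/η_S)`** — DDT (3.5.2) in COTANGENT currency (no Selmer
  group, no period-ring parameter in the STATEMENT: Lemma 2.40 lives inside the proof), and the
  Σ-induction of DDT p. 101 ((3.5.1) + Prop. 3.35 + Thm. 3.36 ⇒ (3.5.2)) is ADDITIVE in lengths:
  PROVED here as the bookkeeping lemma `lengthIneq_induction` (MIN + COT-steps + IHARA-steps ⇒ INEQ).
  Also PROVED: `congruenceIdeal_ne_bot_of_isReduced` (η ≠ 0 ⟸ `T` reduced ∧ `Ann_T(ker π) ≠ 0`),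
  `carrierSS_baseChange_eq` (O-valued base point vs. the ℤ̄₅-valued `ρ₀` of X⁵), and the concrete
  candidate `heckeAlgebraSS` (= the tree's `heckeAlgebraOfTypeSigma` over the semistable-at-`p`
  carrier, `25 ∤ N` i.e. `¬ p² ∣ M`) with its augmentation and reducedness.

Kernel-checked content (NO `sorry`; helper STATEMENTS are `def … : Prop`, every `theorem` is proved).
Copied VERBATIM from `StubIdeas.LiftFive2g11` (crux workfiles never import each other):
`modularLiftsOfTypeSigmaSemistable`, `residualModFive`, `DiamondCor62FrobTraceFiveOrd` (X⁵).
-/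

noncomputable section

open scoped MatrixGroups Matrix NumberField ModularForm Polynomial Classical NNReal
open NumberField IsDedekindDomain IsDedekindDomain.HeightOneSpectrum Polynomial Filter
open Literature.NumberTheory Literature.NumberTheory.Automorphic Literature.NumberTheory.Automorphic.BCDT
open Literature.NumberTheory.GaloisRepresentations Literature.NumberTheory.GaloisRepresentations.ModPGaloisRep
open Literature.NumberTheory.EllipticCurves Literature.NumberTheory.EllipticCurves.ModularForms
open Literature.RingTheory.CompleteIntersection
open CongruenceSubgroup Rat.HeightOneSpectrum WeierstrassCurve Field IsLocalRing

set_option linter.dupNamespace false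

namespace Summit.ABC.ABC.Cruxes.FreyModularity.StubIdeas.LiftFive2g12

universe u v

/-! ### Carrier (gen 7–11, VERBATIM) and the trace Hecke algebra over it (NEW, tree pattern) -/

section Carrier

variable (p : ℕ) (k : ℤ) {O : Type u} [CommRing O] [TopologicalSpace O]
  (Ō : Type v) [CommRing Ō] [IsLocalRing Ō] [TopologicalSpace Ō] [Algebra O Ō]
  (ρ : FramedGaloisRep ℚ O 2) (S : Set ℕ)

/-- `N_Σ^{ss}(Ō)` = Diamond's `Φ_Σ` — verbatim `modularLiftsOfTypeSigma` (DFG §3.1) with the level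
condition `¬ p ∣ M` relaxed to `¬ p ^ 2 ∣ M` (DDT Def. 3.25 / Lemma 3.26; Diamond CSS XVII §5:
"`N_g` not divisible by `ℓ²`").  Identical to gens 7–11.
[cite: DarmonDiamondTaylor1995, §3.3 (p. 94)] [cite: Diamond1997CSS, §5 (p. 571)] -/
def modularLiftsOfTypeSigmaSemistable : Set (FramedGaloisRep ℚ Ō 2) :=
  {ρ' | (∃ (M : ℕ) (_ : NeZero M) (g : CuspForm (Gamma1 M) k) (j : coeffCharIntegers g →+* Ō),
          IsNewform1 g ∧ ¬ p ^ 2 ∣ M ∧ IsGaloisRepOfNewform1Int g j {r | r ∣ M * p} ρ') ∧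
      (∀ (σ : absoluteGaloisGroup ℚ) (i : ℕ),
          (FramedRep.charpoly ρ' σ).coeff i - algebraMap O Ō ((FramedRep.charpoly ρ σ).coeff i) ∈
            maximalIdeal Ō) ∧
      (∀ σ : absoluteGaloisGroup ℚ,
          ((ρ' σ : GL (Fin 2) Ō) : Matrix (Fin 2) (Fin 2) Ō).det =
            algebraMap O Ō ((ρ σ : GL (Fin 2) O) : Matrix (Fin 2) (Fin 2) O).det) ∧
      ∀ v : HeightOneSpectrum (𝓞 ℚ), ((primesEquiv v : Nat.Primes) : ℕ) ∉ S →
        ((primesEquiv v : Nat.Primes) : ℕ) ≠ p → ρ'.IsMinimallyRamifiedAt v}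

/-- **Trace tuples over the semistable carrier** `T_σ = (tr ρ(σ), (tr ρ'(σ))_{ρ' ∈ Φ_S})` — the
tree's `traceTuple` with `modularLiftsOfTypeSigma` replaced by `Φ_S^{ss}`.
[cite: DarmonDiamondTaylor1995, §3.3, p. 94] -/
def traceTupleSS (σ : absoluteGaloisGroup ℚ) :
    O × (modularLiftsOfTypeSigmaSemistable p k Ō ρ S → Ō) :=
  (FramedRep.trace ρ σ, fun ρ' => FramedRep.trace (ρ' : FramedGaloisRep ℚ Ō 2) σ)

/-- **CANDIDATE `T_S`: the Hecke algebra of type `S`, semistable at `p`** — the `O`-subalgebra of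
`O × ∏_{Φ_S^{ss}} Ō` generated by the trace tuples of good Frobenius elements (tree's
`IsGoodFrobenius`: `r ∉ S ∪ {p}`, `ρ` unramified at `r`); DDT §3.3 p. 94 "define `T_Σ` to be the
`O`-subalgebra of `T̃_Σ` generated by the elements `T_p`", here WITH `ℓ ∥ N_f` allowed (Lemma 3.26,
`δ = 1`). [cite: DarmonDiamondTaylor1995, §3.3, p. 94 and Lemma 3.26] -/
def heckeAlgebraSS : Subalgebra O (O × (modularLiftsOfTypeSigmaSemistable p k Ō ρ S → Ō)) :=
  Algebra.adjoin O (traceTupleSS p k Ō ρ S '' {σ | IsGoodFrobenius p ρ S σ})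

variable {p k Ō ρ S} in
/-- The generators lie in `T_S`. [folklore] -/
theorem traceTupleSS_mem {σ : absoluteGaloisGroup ℚ} (hσ : IsGoodFrobenius p ρ S σ) :
    traceTupleSS p k Ō ρ S σ ∈ heckeAlgebraSS p k Ō ρ S :=
  Algebra.subset_adjoin ⟨σ, hσ, rfl⟩

/-- **The augmentation `π_f : T_S →ₐ[O] O`** (first projection; DDT p. 96 "`π = π_f : T_Σ → O`").
[cite: DarmonDiamondTaylor1995, §3.3, p. 96] -/
def heckeAlgebraSS.augmentation : heckeAlgebraSS p k Ō ρ S →ₐ[O] O :=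
  (AlgHom.fst O O (modularLiftsOfTypeSigmaSemistable p k Ō ρ S → Ō)).comp
    (heckeAlgebraSS p k Ō ρ S).val

/-- `T_S` is reduced when `O`, `Ō` are (DDT p. 94 "Moreover it is reduced"; proof = the tree's
`heckeAlgebraOfTypeSigma.isReduced`, verbatim). [cite: DarmonDiamondTaylor1995, §3.3, p. 94] -/
theorem heckeAlgebraSS.isReduced [IsReduced O] [IsReduced Ō] :
    IsReduced (heckeAlgebraSS p k Ō ρ S) := by
  refine ⟨fun x hx => ?_⟩
  obtain ⟨m, hm⟩ := hx
  have hm' : ((x : O × (modularLiftsOfTypeSigmaSemistable p k Ō ρ S → Ō))) ^ m = 0 := by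
    rw [← SubmonoidClass.coe_pow, hm]; rfl
  refine Subtype.ext (Prod.ext ?_ (funext fun ρ' => ?_))
  · exact IsReduced.eq_zero _ ⟨m, by rw [← Prod.pow_fst, hm']; rfl⟩
  · exact IsReduced.eq_zero _ ⟨m, by rw [← Pi.pow_apply, ← Prod.pow_snd, hm']; rfl⟩

variable {p k Ō ρ S} in
/-- (PROVED) **CARR — O-valued vs. `Ō`-valued base point.**  X⁵ indexes Diamond's `Φ_S` by the
`ℤ̄₅`-valued `ρ₀`; the Hecke algebra needs an `O`-valued lattice `ρO` (`O` a DVR containing the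
Hecke field of the newform behind `ρ₀`).  If `ρ₀ = ρO ⊗_O Ō` the two carriers are THE SAME SET. -/
theorem carrierSS_baseChange_eq (hc : Continuous (algebraMap O Ō)) :
    modularLiftsOfTypeSigmaSemistable p k Ō (FramedRep.baseChange (algebraMap O Ō) hc ρ) S =
      modularLiftsOfTypeSigmaSemistable p k Ō ρ S := by
  ext ρ'
  have hcoeff : ∀ (σ : absoluteGaloisGroup ℚ) (i : ℕ),
      algebraMap Ō Ō ((FramedRep.charpoly (FramedRep.baseChange (algebraMap O Ō) hc ρ) σ).coeff i) =
        algebraMap O Ō ((FramedRep.charpoly ρ σ).coeff i) := fun σ i => by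
    rw [FramedRep.charpoly_baseChange, Polynomial.coeff_map]; rfl
  have hdet : ∀ σ : absoluteGaloisGroup ℚ,
      algebraMap Ō Ō (((FramedRep.baseChange (algebraMap O Ō) hc ρ) σ : GL (Fin 2) Ō) :
          Matrix (Fin 2) (Fin 2) Ō).det =
        algebraMap O Ō ((ρ σ : GL (Fin 2) O) : Matrix (Fin 2) (Fin 2) O).det := fun σ => by
    rw [FramedRep.coe_baseChange_apply, ← RingHom.mapMatrix_apply, ← RingHom.map_det]; rfl
  simp only [modularLiftsOfTypeSigmaSemistable, Set.mem_setOf_eq, hcoeff, hdet]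

end Carrier

/-! ### X⁵ (gen 11's W-free debt, VERBATIM) -/

/-- `ρ̄ ⊗ 𝔽̄₅` (verbatim, gen 11). [folklore] -/
def residualModFive (ρ : ModPGaloisRep ℚ (ZMod 5) 2) :
    absoluteGaloisGroup ℚ →* GL (Fin 2) (padicAlgClResidueField 5) :=
  (Matrix.GeneralLinearGroup.map (zmodToPadicAlgClResidueField 5)).comp
    (ρ : absoluteGaloisGroup ℚ →* GL (Fin 2) (ZMod 5))

/-- **X⁵ `DiamondCor62FrobTraceFiveOrd`** (gen 11's debt, VERBATIM; Diamond CSS XVII Cor. 6.2 / DDT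
Cor. 3.46 at `ℓ = 5`, ordinary regime, Frobenius-trace currency).
[cite: Diamond1997CSS, Cor. 6.2 (p. 571)] [cite: DarmonDiamondTaylor1995, Cor. 3.46 (p. 102), Thm. 3.42] -/
def DiamondCor62FrobTraceFiveOrd : Prop :=
  ∀ (ρ : ModPGaloisRep ℚ (ZMod 5) 2) (τ : FramedGaloisRep ℚ (PadicAlgCl 5) 2),
    ρ.IsAbsIrreducibleOverSqrt 5 →
    HasResidualCharpolys (RingHom.id (padicAlgClResidueField 5))
      (τ : absoluteGaloisGroup ℚ →* GL (Fin 2) (PadicAlgCl 5)) (residualModFive ρ) →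
    (∀ σ : absoluteGaloisGroup ℚ,
      ((τ σ : GL (Fin 2) (PadicAlgCl 5)) : Matrix (Fin 2) (Fin 2) (PadicAlgCl 5)).det =
        algebraMap ℚ_[5] (PadicAlgCl 5) (PadicInt.Coe.ringHom (p := 5)
          ((GaloisRep.cyclotomicCharacter ℚ 5 σ : ℤ_[5]ˣ) : ℤ_[5]))) →
    ∀ (ρ₀ : FramedGaloisRep ℚ (padicAlgClIntegers 5) 2) (S : Set ℕ),
      ρ₀ ∈ modularLiftsOfTypeSigmaSemistable 5 2 (padicAlgClIntegers 5) ρ₀ S →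
      (∀ (σ : absoluteGaloisGroup ℚ) (i : ℕ),
        Valued.v (((FramedRep.charpoly ρ₀ σ).coeff i : PadicAlgCl 5) -
          (FramedRep.charpoly τ σ).coeff i) < 1) →
      (∀ σ : absoluteGaloisGroup ℚ,
        (((ρ₀ σ : GL (Fin 2) (padicAlgClIntegers 5)) :
            Matrix (Fin 2) (Fin 2) (padicAlgClIntegers 5)).det : PadicAlgCl 5) =
          ((τ σ : GL (Fin 2) (PadicAlgCl 5)) : Matrix (Fin 2) (Fin 2) (PadicAlgCl 5)).det) →
      S.Finite → 5 ∉ S →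
      (∀ v : HeightOneSpectrum (𝓞 ℚ), ((primesEquiv v : Nat.Primes) : ℕ) ∉ S →
        ((primesEquiv v : Nat.Primes) : ℕ) ≠ 5 → τ.IsUnramifiedAt v) →
      (∀ v : HeightOneSpectrum (𝓞 ℚ), ((5 : ℕ) : 𝓞 ℚ) ∈ v.asIdeal →
        FramedGaloisRep.IsOrdinaryOfWeightAt 5 τ v 2 1) →
      ∃ ρ' ∈ modularLiftsOfTypeSigmaSemistable 5 2 (padicAlgClIntegers 5) ρ₀ S,
        ∃ S' : Set (HeightOneSpectrum (𝓞 ℚ)), S'.Finite ∧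
          ∀ v ∉ S', ∀ 𝔓 ∈ v.primesAbove, ∀ σ : absoluteGaloisGroup ℚ, IsArithFrobAt (𝓞 ℚ) σ 𝔓 →
            ((FramedRep.trace ρ' σ : padicAlgClIntegers 5) : PadicAlgCl 5) = FramedRep.trace τ σ

/-! ### T-A (gen 12) — the `R → T` INTERFACE of type `S` and the ring-currency debt -/

/-- **Type-`S` lifts** — hypotheses (a)–(e) of X⁵ on `τ : Γ_ℚ → GL₂(ℚ̄₅)`, packaged (residually
`ρ̄ ⊗ 𝔽̄₅`; `det = χ₅`; `≡ ρ₀ mod 𝔪` with `det = det ρ₀`; unramified off `S ∪ {5}`; ordinary of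
weight `2` at `5`) = "`τ` is a deformation of `ρ̄` of type `S`" (DDT §2.7, p. 77, with `5 ∈ Σ`
bookkept separately: at `5` only semistability is demanded, here its ordinary half).
[cite: DarmonDiamondTaylor1995, §2.7 (p. 77) and Cor. 3.46 (a)–(d)] -/
def IsTypeSLift (S : Set ℕ) (ρ : ModPGaloisRep ℚ (ZMod 5) 2)
    (ρ₀ : FramedGaloisRep ℚ (padicAlgClIntegers 5) 2) (τ : FramedGaloisRep ℚ (PadicAlgCl 5) 2) :
    Prop :=
  HasResidualCharpolys (RingHom.id (padicAlgClResidueField 5))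
      (τ : absoluteGaloisGroup ℚ →* GL (Fin 2) (PadicAlgCl 5)) (residualModFive ρ) ∧
  (∀ σ : absoluteGaloisGroup ℚ,
      ((τ σ : GL (Fin 2) (PadicAlgCl 5)) : Matrix (Fin 2) (Fin 2) (PadicAlgCl 5)).det =
        algebraMap ℚ_[5] (PadicAlgCl 5) (PadicInt.Coe.ringHom (p := 5)
          ((GaloisRep.cyclotomicCharacter ℚ 5 σ : ℤ_[5]ˣ) : ℤ_[5]))) ∧
  (∀ (σ : absoluteGaloisGroup ℚ) (i : ℕ),
      Valued.v (((FramedRep.charpoly ρ₀ σ).coeff i : PadicAlgCl 5) -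
        (FramedRep.charpoly τ σ).coeff i) < 1) ∧
  (∀ σ : absoluteGaloisGroup ℚ,
      (((ρ₀ σ : GL (Fin 2) (padicAlgClIntegers 5)) :
          Matrix (Fin 2) (Fin 2) (padicAlgClIntegers 5)).det : PadicAlgCl 5) =
        ((τ σ : GL (Fin 2) (PadicAlgCl 5)) : Matrix (Fin 2) (Fin 2) (PadicAlgCl 5)).det) ∧
  (∀ v : HeightOneSpectrum (𝓞 ℚ), ((primesEquiv v : Nat.Primes) : ℕ) ∉ S →
      ((primesEquiv v : Nat.Primes) : ℕ) ≠ 5 → τ.IsUnramifiedAt v) ∧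
  (∀ v : HeightOneSpectrum (𝓞 ℚ), ((5 : ℕ) : 𝓞 ℚ) ∈ v.asIdeal →
      FramedGaloisRep.IsOrdinaryOfWeightAt 5 τ v 2 1)

/-- **THE INTERFACE: an `R → T` datum of type `S`** over a coefficient ring `O` with
`ι : O → ℚ̄₅` (intended: `O = O_K`, `K/ℚ₅` finite containing the Hecke field of the newform
behind `ρ₀`; `R = R_S` the universal type-`S` deformation ring of `ρ̄`, DDT Thm. 2.41; `T = T_S`
the trace Hecke algebra `heckeAlgebraSS`, DDT §3.3; `φ = φ_Σ` of Lemma 3.27 (a); `π = π_f` of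
p. 96; `trR v = tr ρ^univ(Frob_v)`, `trT v = T_v`).  ONLY the two interpretation axioms used by
OUT are fields; everything else (existence, surjectivity, `η ≠ 0`, the inequality) is a separate
STATEMENT below — the interface smuggles in no existence.
* `univ` (DDT Thm. 2.41 + Cor. 3.46, first half of its proof: "there is an `O`-algebra
  homomorphism `R_Σ → O` such that `ρ = ρ^univ_Σ ⊗ O`"): every type-`S` lift has an `O`-point of `R`
  reading off its Frobenius traces;
* `modular` (DDT Remark 3.33: "to give an `O`-algebra homomorphism `T_Σ → O` is equivalent to
  giving a newform `f` in `N_Σ`"): every `O`-point of `T` is a member of `Φ_S(ρ₀)`, traces matching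
  off a finite set.
[cite: DarmonDiamondTaylor1995, Thm. 2.41 (p. 77), Lemma 3.27 (p. 94), Remark 3.33 (p. 96), Cor. 3.46 (p. 102)] -/
structure RTDatum (O R T : Type) [CommRing O] [CommRing R] [Algebra O R] [CommRing T]
    [Algebra O T] (ι : O →+* PadicAlgCl 5) (S : Set ℕ) (ρ : ModPGaloisRep ℚ (ZMod 5) 2)
    (ρ₀ : FramedGaloisRep ℚ (padicAlgClIntegers 5) 2) where
  /-- `φ_S : R_S → T_S` (DDT Lemma 3.27 (a)). -/
  φ : R →ₐ[O] T
  /-- `π_f : T_S → O` (DDT p. 96). -/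
  π : T →ₐ[O] O
  /-- universal Frobenius traces `tr ρ^univ_S(Frob_v)`. -/
  trR : HeightOneSpectrum (𝓞 ℚ) → R
  /-- Hecke operators `T_v`. -/
  trT : HeightOneSpectrum (𝓞 ℚ) → T
  /-- `φ_S (tr ρ^univ(Frob_v)) = T_v` (Lemma 3.27: `tr ρ^mod_Σ(Frob_p) = T_p`, `ρ^mod ∼ φ ∘ ρ^univ`). -/
  φ_trR : ∀ v, φ (trR v) = trT v
  /-- universality on type-`S` lifts (Thm. 2.41). -/
  univ : ∀ τ : FramedGaloisRep ℚ (PadicAlgCl 5) 2, IsTypeSLift S ρ ρ₀ τ →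
    ∃ ψ : R →+* PadicAlgCl 5, (∀ x : O, ψ (algebraMap O R x) = ι x) ∧
      ∀ v : HeightOneSpectrum (𝓞 ℚ), ((primesEquiv v : Nat.Primes) : ℕ) ∉ S →
        ((primesEquiv v : Nat.Primes) : ℕ) ≠ 5 →
        ∀ 𝔓 ∈ v.primesAbove, ∀ σ : absoluteGaloisGroup ℚ, IsArithFrobAt (𝓞 ℚ) σ 𝔓 →
          ψ (trR v) = FramedRep.trace τ σ
  /-- modularity of `O`-points of `T` (Remark 3.33). -/
  modular : ∀ θ : T →+* PadicAlgCl 5, (∀ x : O, θ (algebraMap O T x) = ι x) →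
    ∃ ρ' ∈ modularLiftsOfTypeSigmaSemistable 5 2 (padicAlgClIntegers 5) ρ₀ S,
      ∃ S' : Set (HeightOneSpectrum (𝓞 ℚ)), S'.Finite ∧
        ∀ v ∉ S', ∀ 𝔓 ∈ v.primesAbove, ∀ σ : absoluteGaloisGroup ℚ, IsArithFrobAt (𝓞 ℚ) σ 𝔓 →
          ((FramedRep.trace ρ' σ : padicAlgClIntegers 5) : PadicAlgCl 5) = θ (trT v)

/-- **`RTIsoExists` — the debt in RING currency** (DDT Thm. 3.42 at `ℓ = 5`, iso half: "for all
finite sets `Σ ⊂ Σ_ρ̄`, `φ_Σ : R_Σ → T_Σ` is an isomorphism"): for every absolutely-irreducible-on-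
`ℚ(√5)` `ρ̄` and every modular base point `ρ₀ ∈ Φ_S(ρ₀)`, `S` finite `∌ 5`, SOME datum has
`φ` bijective.  Equivalent in strength to X⁵ given `modular` (take `R := T`): a RESHAPE, not a
weakening — its point is the split `RTNumericalExists` below.
[cite: DarmonDiamondTaylor1995, Thm. 3.42 (p. 100)] [cite: Diamond1996, Thm. 5.3] -/
def RTIsoExists : Prop :=
  ∀ (ρ : ModPGaloisRep ℚ (ZMod 5) 2) (ρ₀ : FramedGaloisRep ℚ (padicAlgClIntegers 5) 2) (S : Set ℕ),
    ρ.IsAbsIrreducibleOverSqrt 5 →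
    ρ₀ ∈ modularLiftsOfTypeSigmaSemistable 5 2 (padicAlgClIntegers 5) ρ₀ S → S.Finite → 5 ∉ S →
    ∃ (O : Type) (_ : CommRing O) (R : Type) (_ : CommRing R) (_ : Algebra O R)
      (T : Type) (_ : CommRing T) (_ : Algebra O T) (ι : O →+* PadicAlgCl 5)
      (𝓓 : RTDatum O R T ι S ρ ρ₀), Function.Bijective 𝓓.φ

/-- **`RTNumericalExists` — the debt in LENGTH currency** (DDT (3.5.2) + Lemma 3.27 (a) + (3.3.1)
"because `T_Σ'` is reduced, `η_Σ' ≠ (0)`"): SOME datum has `O` a DVR, `R` local Noetherian, `T` finite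
free over `O`, `φ` SURJECTIVE, `η_T = π(Ann_T ker π) ≠ 0`, and
`length_O(℘/℘²) ≤ length_O(O/η_T)`, `℘ = ker(π ∘ φ)` — exactly the hypotheses of the tree's PROVED
`bijective_of_length_cotangentModule_le`.  This is where Taylor–Wiles (minimal level, (3.5.1)) and
Ihara/level-raising (Thm. 3.36) live; nothing else of `R = T` does.
[cite: DarmonDiamondTaylor1995, (3.5.1)–(3.5.2) (p. 101), Thm. 3.40, Cor. 3.45 (a)] [cite: DeSmitRubinSchoof1997, Criterion I] -/
def RTNumericalExists : Prop :=
  ∀ (ρ : ModPGaloisRep ℚ (ZMod 5) 2) (ρ₀ : FramedGaloisRep ℚ (padicAlgClIntegers 5) 2) (S : Set ℕ),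
    ρ.IsAbsIrreducibleOverSqrt 5 →
    ρ₀ ∈ modularLiftsOfTypeSigmaSemistable 5 2 (padicAlgClIntegers 5) ρ₀ S → S.Finite → 5 ∉ S →
    ∃ (O : Type) (_ : CommRing O) (_ : IsDomain O) (_ : IsDiscreteValuationRing O)
      (R : Type) (_ : CommRing R) (_ : IsLocalRing R) (_ : IsNoetherianRing R) (_ : Algebra O R)
      (T : Type) (_ : CommRing T) (_ : Algebra O T) (_ : Module.Finite O T) (_ : Module.Free O T)
      (ι : O →+* PadicAlgCl 5) (𝓓 : RTDatum O R T ι S ρ ρ₀),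
      Function.Surjective 𝓓.φ ∧ congruenceIdeal 𝓓.π ≠ ⊥ ∧
        Module.length O (CotangentModule (𝓓.π.comp 𝓓.φ)) ≤
          Module.length O (CongruenceModule 𝓓.π)

/-- **Criterion I** (de Smit–Rubin–Schoof; DDT Thm. 3.40 (a) ⇒ (c), iso half; Lenstra, Lemma 8) —
the VERBATIM type (at universe 0) of the tree's PROVED, sorry-free
`Literature.RingTheory.CompleteIntersection.bijective_of_length_cotangentModule_le`
(`CriterionOne.lean:320`).  Stated as a `Prop` here only because the farm snapshot used for this
check reports `CriterionOne` unbuilt (rc 75 `remote:stale:…:unbuilt`); with that module in scope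
`criterionI_holds : CriterionI := fun _ _ _ _ _ _ _ _ _ _ _ _ _ _ φ π h₁ h₂ h₃ =>
bijective_of_length_cotangentModule_le φ π h₁ h₂ h₃` is the one-line discharge (NOT a debt).
[cite: DeSmitRubinSchoof1997, Criterion I] [cite: DarmonDiamondTaylor1995, Thm. 3.40 (p. 99)] -/
def CriterionI : Prop :=
  ∀ (O : Type) [CommRing O] [IsDomain O] [IsDiscreteValuationRing O]
    (A : Type) [CommRing A] [IsLocalRing A] [IsNoetherianRing A] [Algebra O A]
    (B : Type) [CommRing B] [Algebra O B] [Module.Finite O B] [Module.Free O B]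
    (φ : A →ₐ[O] B) (π : B →ₐ[O] O), Function.Surjective φ → congruenceIdeal π ≠ ⊥ →
    Module.length O (CotangentModule (π.comp φ)) ≤ Module.length O (CongruenceModule π) →
    Function.Bijective φ

/-- (PROVED) **ISO: Criterion I ⊢ `RTNumericalExists → RTIsoExists`** — one application of the
numerical criterion (in the tree: `bijective_of_length_cotangentModule_le`, sorry-free). -/
theorem rtIsoExists_of_numerical (hI : CriterionI) (h : RTNumericalExists) : RTIsoExists := by
  intro ρ ρ₀ S hirr hρ₀ hSfin h5S
  obtain ⟨O, _, _, _, R, _, _, _, _, T, _, _, _, _, ι, 𝓓, hsurj, hη, hle⟩ :=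
    h ρ ρ₀ S hirr hρ₀ hSfin h5S
  exact ⟨O, inferInstance, R, inferInstance, inferInstance, T, inferInstance, inferInstance, ι, 𝓓,
    hI O R T 𝓓.φ 𝓓.π hsurj hη hle⟩

/-- Places of `ℚ` over a finite set of rational primes form a finite set. [folklore] -/
theorem finite_places_over {P : Set ℕ} (hP : P.Finite) :
    {v : HeightOneSpectrum (𝓞 ℚ) | ((primesEquiv v : Nat.Primes) : ℕ) ∈ P}.Finite := by
  refine Set.Finite.preimage (f := fun v : HeightOneSpectrum (𝓞 ℚ) => ((primesEquiv v : Nat.Primes) : ℕ))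
    (fun a _ b _ hab => ?_) hP
  exact primesEquiv.injective (Subtype.val_injective hab)

/-- (PROVED) **OUT: `RTIsoExists → X⁵`** (= the proof of DDT Cor. 3.46, p. 102: "there is an
`O`-algebra homomorphism `R_Σ → O` … since `φ_Σ` is an isomorphism … there is a homomorphism
`T_Σ → O` sending `T_p` to `tr ρ(Frob_p)` … necessarily of the form `T_p ↦ a_p(f)`"): pure algebra,
`θ := ψ_τ ∘ φ⁻¹`. -/
theorem x5_of_rtIsoExists (h : RTIsoExists) : DiamondCor62FrobTraceFiveOrd := by
  intro ρ τ hirr hres hdetχ ρ₀ S hρ₀ hcong hdet₀ hSfin h5S hur hord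
  obtain ⟨O, _, R, _, _, T, _, _, ι, 𝓓, hbij⟩ := h ρ ρ₀ S hirr hρ₀ hSfin h5S
  obtain ⟨ψ, hψO, hψ⟩ := 𝓓.univ τ ⟨hres, hdetχ, hcong, hdet₀, hur, hord⟩
  -- `e = φ` as an isomorphism, `θ = ψ ∘ e⁻¹ : T → ℚ̄₅`
  let e : R ≃ₐ[O] T := AlgEquiv.ofBijective 𝓓.φ hbij
  have he_tr : ∀ v, e.symm (𝓓.trT v) = 𝓓.trR v := fun v => by
    rw [AlgEquiv.symm_apply_eq]
    exact (𝓓.φ_trR v).symm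
  let θ : T →+* PadicAlgCl 5 := ψ.comp (e.symm.toAlgHom.toRingHom)
  have hθ : ∀ t : T, θ t = ψ (e.symm t) := fun t => rfl
  have hθO : ∀ x : O, θ (algebraMap O T x) = ι x := fun x => by
    rw [hθ, AlgEquiv.commutes, hψO]
  obtain ⟨ρ', hρ', S', hS'fin, hS'⟩ := 𝓓.modular θ hθO
  refine ⟨ρ', hρ', S' ∪ {v | ((primesEquiv v : Nat.Primes) : ℕ) ∈ S ∪ {5}},
    hS'fin.union (finite_places_over (hSfin.union (Set.finite_singleton 5))), ?_⟩
  intro v hv 𝔓 h𝔓 σ hσ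
  simp only [Set.mem_union, Set.mem_setOf_eq, Set.mem_singleton_iff, not_or] at hv
  obtain ⟨hvS', hvS, hv5⟩ := hv
  rw [hS' v hvS' 𝔓 h𝔓 σ hσ, hθ, he_tr v]
  exact hψ v hvS hv5 𝔓 h𝔓 σ hσ

/-- (PROVED) **Net gen-12 entry: `RTNumericalExists → X⁵`** — the `R = T` output at `5` follows from
three honest ring-theoretic clauses (SURJ, `η ≠ 0`, INEQ) about ONE constructed datum; downstream the
gen-11 chain `debtMult_of_X5_ORD` (X⁵ + ORD ⇒ X′ₘ) and the gen-9 one-cycle adapters reach case B. -/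
theorem x5_of_numerical (hI : CriterionI) (h : RTNumericalExists) : DiamondCor62FrobTraceFiveOrd :=
  x5_of_rtIsoExists (rtIsoExists_of_numerical hI h)

/-! ### T-B helpers: `η ≠ 0` from reducedness, and the Σ-induction in LENGTH currency -/

section Eta

variable {O' : Type*} [CommRing O'] {T' : Type*} [CommRing T'] [Algebra O' T'] (π : T' →ₐ[O'] O')

/-- (PROVED) For REDUCED `T`, `ker π ∩ Ann_T(ker π) = 0` (an element of both squares to zero).
[folklore] -/
theorem ker_inf_annihilator_eq_bot_of_isReduced [IsReduced T'] :
    RingHom.ker π ⊓ (RingHom.ker π).annihilator = ⊥ := by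
  refine eq_bot_iff.mpr fun x hx => ?_
  obtain ⟨hxI, hxA⟩ := hx
  rw [Ideal.mem_bot]
  have hx2 : x * x = 0 := by
    simpa [smul_eq_mul] using Submodule.mem_annihilator.mp hxA x hxI
  exact IsReduced.eq_zero x ⟨2, by rw [pow_two]; exact hx2⟩

/-- (PROVED) **RED ⇒ ETA reduction**: for reduced `T`, `η_T ≠ 0` as soon as `Ann_T(ker π) ≠ 0`
(DDT (3.3.1): "because `T_Σ'` is reduced, `η_Σ' ≠ (0)`" — the remaining content, `Ann ≠ 0`, is the
statement `AnnKerNeBot` below). [cite: DarmonDiamondTaylor1995, (3.3.1), p. 97] -/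
theorem congruenceIdeal_ne_bot_of_isReduced [IsReduced T']
    (hA : (RingHom.ker π).annihilator ≠ ⊥) : congruenceIdeal π ≠ ⊥ := by
  intro hη
  rw [congruenceIdeal_eq_bot_iff] at hη
  apply hA
  have h := ker_inf_annihilator_eq_bot_of_isReduced π
  rwa [inf_eq_right.mpr hη] at h

end Eta

/-- **H-ANN `AnnKerNeBot`** (M, Mathlib-only, REUSABLE by every `R = T` route incl.
stmt-Langlands-14534): for `T` reduced, finite and free over a domain `O`, and any augmentation
`π : T →ₐ[O] O`, `Ann_T(ker π) ≠ 0`.  Proof sketch: on the generic fibre `T ⊗ K = K × T'_K`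
(reduced Artinian ⇒ product of fields, `π_K` = a projection), the idempotent `e = (1,0)` has a
multiple `d e ∈ T`, `d ≠ 0`, killing `ker π`. With `congruenceIdeal_ne_bot_of_isReduced` this gives
`η_T ≠ 0` (DDT (3.3.1)). [cite: DarmonDiamondTaylor1995, (3.3.1), p. 97] [cite: Hida2000, §5.3.3] -/
def AnnKerNeBot : Prop :=
  ∀ (O T : Type) [CommRing O] [IsDomain O] [CommRing T] [Algebra O T] [IsReduced T]
    [Module.Finite O T] [Module.Free O T] (π : T →ₐ[O] O), (RingHom.ker π).annihilator ≠ ⊥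

/-- (PROVED) **Σ-INDUCTION IN LENGTH CURRENCY** (the bookkeeping of DDT's proof of Thm. 3.42,
p. 101: minimal equality (3.5.1) + Prop. 3.35 (cotangent side grows by at most `Σ_p length O/π(c_p)`)
+ Thm. 3.36 (congruence side grows by at least as much, Ihara) ⇒ (3.5.2) for every `Σ ⊇ Σ_min`).
Abstractly: `a S` = `length_O(℘_S/℘_S²)`, `b S` = `length_O(O/η_S)`, `c p` = `length_O(O/π(c_p))`.
[cite: DarmonDiamondTaylor1995, proof of Thm. 3.42 (p. 101), Prop. 3.35, Thm. 3.36, Cor. 3.37] -/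
theorem lengthIneq_induction {ι : Type*} [DecidableEq ι] (a b : Finset ι → ℕ∞) (c : ι → ℕ∞)
    (S₀ : Finset ι) (hmin : a S₀ ≤ b S₀)
    (hcot : ∀ S : Finset ι, S₀ ⊆ S → ∀ i ∉ S, a (insert i S) ≤ a S + c i)
    (hih : ∀ S : Finset ι, S₀ ⊆ S → ∀ i ∉ S, b S + c i ≤ b (insert i S))
    (D : Finset ι) : a (S₀ ∪ D) ≤ b (S₀ ∪ D) := by
  induction D using Finset.induction_on with
  | empty => simpa using hmin
  | insert i D _hi ih =>
    by_cases hmem : i ∈ S₀ ∪ D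
    · have hset : S₀ ∪ insert i D = S₀ ∪ D := by
        rw [Finset.union_insert, Finset.insert_eq_of_mem hmem]
      rw [hset]
      exact ih
    · rw [Finset.union_insert]
      calc a (insert i (S₀ ∪ D)) ≤ a (S₀ ∪ D) + c i := hcot _ Finset.subset_union_left i hmem
        _ ≤ b (S₀ ∪ D) + c i := add_le_add ih le_rfl
        _ ≤ b (insert i (S₀ ∪ D)) := hih _ Finset.subset_union_left i hmem

/-! ### The Galois-side helper STATEMENTS over the concrete candidate `heckeAlgebraSS` (typed, not proved) -/

/-- **H-FREE5** (L; DDT p. 94 "`T_Σ` is a complete noetherian local `O`-algebra … finitely generated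
free `O`-module"): for `O` a DVR, module-finite over `ℤ₅` inside `ℤ̄₅`, and an `O`-valued base point
`ρO`, the candidate `T_S = heckeAlgebraSS 5 2 ℤ̄₅ ρO S` is finite and free over `O`.  Why it might
fail as typed: finiteness needs the finiteness of newforms of weight 2 and level dividing
`5·N(ρ̄)·∏_{S} p²` (finite-dimensionality of `S₂(Γ₁(M))`, not in Mathlib) and that only finitely many
`(g, j)` occur; freeness = torsion-free + finite over a PID.
[cite: DarmonDiamondTaylor1995, §3.3, p. 94] [cite: DiamondShurman2005, Thm. 3.5.1 (dimension formulas)] -/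
def HeckeSSFiniteFree : Prop :=
  ∀ (O : Type) [CommRing O] [IsDomain O] [IsDiscreteValuationRing O] [TopologicalSpace O]
    [Algebra ℤ_[5] O] [Module.Finite ℤ_[5] O] [Algebra O (padicAlgClIntegers 5)]
    (ρO : FramedGaloisRep ℚ O 2) (S : Set ℕ), S.Finite →
    Function.Injective (algebraMap O (padicAlgClIntegers 5)) →
    Module.Finite O (heckeAlgebraSS 5 2 (padicAlgClIntegers 5) ρO S) ∧
      Module.Free O (heckeAlgebraSS 5 2 (padicAlgClIntegers 5) ρO S)

/-- **H-MODPTS5** (L; DDT Remark 3.33 "to give an `O`-algebra homomorphism `T_Σ → O` is equivalent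
to giving a newform `f` in `N_Σ`", here for `ℚ̄₅`-points): every ring map `θ : T_S → ℚ̄₅` compatible
with `O → ℤ̄₅ → ℚ̄₅` agrees, on the generators `T_σ` (`σ` a good Frobenius at `v`), with
`tr ρ'(σ)` for one member `ρ' ∈ Φ_S(ρO)` and all `v` off a finite set.  Proof sketch: `ker θ ⊇` a
minimal prime `= ker(ev_{ρ'})` (`T_S` finite over `O`, `⋂ ker ev = 0`), then twist the embedding
`ev_{ρ'}(T_S) ↪ ℚ̄₅` into `θ` by `γ ∈ Aut(ℚ̄₅/K)` and replace `ρ'` by `γ ∘ ρ'` (still a member: same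
`g`, embedding `γ ∘ j`).  Why it might fail as typed: needs `Φ_S` stable under `Aut(ℚ̄₅/ι O)` acting
on coefficients (continuity of `γ`: isometry) — true but a separate lemma.
[cite: DarmonDiamondTaylor1995, Remark 3.33 (p. 96), Thm. 1.22] -/
def HeckeSSModularPoints : Prop :=
  ∀ (O : Type) [CommRing O] [IsDomain O] [IsDiscreteValuationRing O] [TopologicalSpace O]
    [Algebra O (padicAlgClIntegers 5)] (ρO : FramedGaloisRep ℚ O 2) (S : Set ℕ), S.Finite →
    ∀ θ : heckeAlgebraSS 5 2 (padicAlgClIntegers 5) ρO S →+* PadicAlgCl 5,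
      (∀ x : O, θ (algebraMap O _ x) =
        ((algebraMap O (padicAlgClIntegers 5) x : padicAlgClIntegers 5) : PadicAlgCl 5)) →
      ∃ ρ' ∈ modularLiftsOfTypeSigmaSemistable 5 2 (padicAlgClIntegers 5) ρO S,
        ∃ S' : Set (HeightOneSpectrum (𝓞 ℚ)), S'.Finite ∧
          ∀ (v : HeightOneSpectrum (𝓞 ℚ)) (𝔓 : Ideal (absIntegers (𝓞 ℚ) ℚ))
            (σ : absoluteGaloisGroup ℚ) (hS : ((primesEquiv v : Nat.Primes) : ℕ) ∉ S)
            (h5 : ((primesEquiv v : Nat.Primes) : ℕ) ≠ 5) (hur : ρO.IsUnramifiedAt v)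
            (h𝔓 : 𝔓 ∈ v.primesAbove) (hσ : IsArithFrobAt (𝓞 ℚ) σ 𝔓), v ∉ S' →
            ((FramedRep.trace ρ' σ : padicAlgClIntegers 5) : PadicAlgCl 5) =
              θ ⟨traceTupleSS 5 2 (padicAlgClIntegers 5) ρO S σ,
                traceTupleSS_mem ⟨v, 𝔓, hS, h5, hur, h𝔓, hσ⟩⟩

end Summit.ABC.ABC.Cruxes.FreyModularity.StubIdeas.LiftFive2g12
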